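import Mathlib
import Literature.NumberTheory.LFunctions.Zhang2022.Section8XiZeroTailMean
import HarnessLib

/-!
# Zhang (2022) §8 p. 47: the absolute logarithmic mean of `ξ₀ⱼ(n;d,r)` — `𝓛`-free form

Topic `Literature/NumberTheory/LFunctions/Zhang2022` (Landau–Siegel audit tree; verdict-neutral).
Y. Zhang, *Discrete mean estimates and the Landau–Siegel zero*, arXiv:2211.02515v1 (2022)
[Zhang2022LandauSiegel], §7 p. 33, §8 p. 47 (display before (8.10)) — **an unrefereed manuscript
under adjudication; this file asserts nothing about its Theorems 1–2.** ZHANG-L discharge lane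
(WP10, seat zl-w10-p2); theorem-only, no new definitions or named facts.

`XiZeroMajorant.xiZeroTailMean` (sz-d37, `Section8XiZeroTailMean`, GAP row G-d20-1) states
`Σ_{n<⌈x⌉} |ξ₀ⱼ(n;d,r)|/n ≤ C·𝓛·(1 + log x)³` for `1 ≤ x ≤ T`, but its proof gives the bound WITHOUT
the factor `𝓛 = log D ≥ 1` (the last step only multiplies by `𝓛`). This file records the sharper
form BY NAME, `xiZeroTailMean_logFree`, with the same proof minus that step. Consumers: the SHORT
log-means of `ξ₀ⱼ` (argument `x < T`) in the window clause of Lemma 10.2 in its derivable reading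
(zl-w10-p6's D3, zl-w10-ref-2's RT-01′ clause-4 memo: `‖𝔳₂ⱼ(d,r)‖ ≤ C·(1 + log T)⁴/log P·R(d,r)`
with this form, i.e. `≈ 𝓛^{−4.6}R` instead of `𝓛^{−3.6}R`), and their §10/§18 consumers
(`Section10CRanges1422` Part NB, the RT-01′ ports of `Section18RangeEdges`, `Section10Range1113*`).

## References

* Y. Zhang, arXiv:2211.02515v1 (2022), §7 p. 33; §8 p. 47 (display before (8.10)).
  [cite: Zhang2022LandauSiegel, §8 p.47]
* R. R. Hall, G. Tenenbaum, *Divisors* (CUP 1988), (0.4). [cite: HallTenenbaum1988, (0.4)]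
-/

noncomputable section

open Finset Real ArithmeticFunction

namespace Literature.NumberTheory.LFunctions.Zhang2022.XiZeroMajorant

open MeanSquareMajorant

/-- **`XiZeroTailMean`, `𝓛`-free form**: there is an absolute `C` such that for all large `D`, every
real primitive `χ (mod D)`, `j ∈ {1,2,3}`, `d, r ≥ 1` (`dr < P₁`) and `1 ≤ x ≤ T`:
`Σ_{n<⌈x⌉} |ξ₀ⱼ(n;d,r)|/n ≤ C·(1 + log x)³`, uniformly in `d, r, j` (same route as `xiZeroTailMean`:
the multiplicative majorant `g ≥ |ξ₀ⱼ|` and `XiZeroMajorant.sum_div_le_gen`, `B log p ≤ 1/8` on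
`p ≤ 2x ≤ 2T`; the final multiplication by `𝓛 ≥ 1` is simply omitted).
[cite: Zhang2022LandauSiegel, §8 p.47 (display before (8.10)); §7 p.33] -/
theorem xiZeroTailMean_logFree (c' : ℝ) : ∃ C : ℝ, Skeleton.ForAllLarge fun D _ _ =>
    ∀ j ∈ ({1, 2, 3} : Finset ℕ), ∀ d r : ℕ, 1 ≤ d → 1 ≤ r →
      ((d * r : ℕ) : ℝ) < Skeleton.P1 D → ∀ x : ℝ, 1 ≤ x → x ≤ Skeleton.bigT D →
        ∑ n ∈ Finset.Ico 1 ⌈x⌉₊, ‖Skeleton.xiZero c' D j n d r‖ / n ≤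
          C * (1 + Real.log x) ^ 3 := by
  set C₀ : ℝ := Real.exp (4 * (3 : ℕ) + (129 / 4 + 5 * M0) * (36 * π) + M0 +
    C5 * LogEulerProduct.tailConst 4) with hC₀
  refine ⟨C₀, ⌈Real.exp (5 * |c'| * π + 3)⌉₊, fun D _ χ hD _ _ j _ d r _ _ _ x hx1 hxT => ?_⟩
  obtain ⟨hL3, hBle⟩ := three_le_ell_and_Bsum_le hD
  set ℓ := Skeleton.ell D with hℓ
  have hℓ1 : 1 ≤ ℓ := by linarith
  have hB0 := Bsum_nonneg c' D
  obtain ⟨hsmall8, hsmall36⟩ := Bsum_mul_le hL3 hBle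
  have hx0 : 0 < x := by linarith
  -- `log x ≤ log T = 𝓛^{1.1} ≤ 𝓛²`
  have hlogx : Real.log x ≤ ℓ ^ 2 := by
    calc Real.log x ≤ Real.log (Skeleton.bigT D) := Real.log_le_log hx0 hxT
      _ = ℓ ^ (1.1 : ℝ) := by rw [Skeleton.bigT, Real.log_exp]
      _ ≤ ℓ ^ (2 : ℝ) := Real.rpow_le_rpow_of_exponent_le hℓ1 (by norm_num)
      _ = ℓ ^ 2 := Real.rpow_two ℓ
  have hlogx0 : 0 ≤ Real.log x := Real.log_nonneg hx1
  have hlog2 : Real.log 2 ≤ 1 := by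
    have := Real.log_le_sub_one_of_pos (show (0:ℝ) < 2 by norm_num); linarith
  -- the smallness `B log y ≤ 1/8` whenever `log y ≤ 3 + 𝓛²`
  have hBsmall : ∀ y : ℝ, Real.log y ≤ 3 + ℓ ^ 2 → Bsum c' D * Real.log y ≤ 1 / 8 := by
    intro y hy
    calc Bsum c' D * Real.log y ≤ Bsum c' D * (3 + ℓ ^ 2) := mul_le_mul_of_nonneg_left hy hB0
      _ ≤ 1 / 8 := hsmall8
  -- the range `X = max ⌈x⌉ 2 ≤ 2x`
  set X : ℕ := max ⌈x⌉₊ 2 with hXdef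
  have hX2 : 2 ≤ X := le_max_right _ _
  have hXle : (X : ℝ) ≤ 2 * x := by
    rw [hXdef, Nat.cast_max]
    refine max_le ?_ (by push_cast; linarith)
    have := Nat.ceil_lt_add_one hx0.le
    linarith
  have hXpos : (0 : ℝ) < X := by exact_mod_cast (show 0 < X by omega)
  have hlogX : Real.log X ≤ 1 + Real.log x := by
    calc Real.log X ≤ Real.log (2 * x) := Real.log_le_log hXpos hXle
      _ = Real.log 2 + Real.log x := Real.log_mul (by norm_num) hx0.ne'
      _ ≤ 1 + Real.log x := by linarith
  have hlogX0 : 0 ≤ Real.log X := Real.log_nonneg (by exact_mod_cast (show 1 ≤ X by omega))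
  have hlog4X : Real.log (4 * X) ≤ 3 + ℓ ^ 2 := by
    have h8 : Real.log (4 * X) ≤ Real.log (8 * x) :=
      Real.log_le_log (by positivity) (by linarith)
    have h8' : Real.log (8 * x) = 3 * Real.log 2 + Real.log x := by
      rw [Real.log_mul (by norm_num) hx0.ne', show (8 : ℝ) = 2 ^ 3 by norm_num, Real.log_pow]
      push_cast; ring
    linarith
  -- primes `p ≤ X`: `B log p ≤ 1/8`
  have hBp : ∀ p, p.Prime → p ≤ X → Bsum c' D * Real.log p ≤ 1 / 8 := by
    intro p hp hpX
    apply hBsmall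
    have hp0 : (0 : ℝ) < p := by exact_mod_cast hp.pos
    calc Real.log p ≤ Real.log X := Real.log_le_log hp0 (by exact_mod_cast hpX)
      _ ≤ 1 + Real.log x := hlogX
      _ ≤ 3 + ℓ ^ 2 := by linarith
  -- termwise majorant on `n < ⌈x⌉`
  have hterm : ∀ n ∈ Finset.Ico 1 ⌈x⌉₊,
      ‖Skeleton.xiZero c' D j n d r‖ / n ≤ gMaj c' D n / n := by
    intro n hn
    obtain ⟨hn1, hnx⟩ := Finset.mem_Ico.mp hn
    have hn0 : n ≠ 0 := by omega
    have hnx' : (n : ℝ) < x := Nat.lt_ceil.mp hnx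
    refine div_le_div_of_nonneg_right (norm_xiZero_le_gMaj c' D hn0 j d r fun q hq => ?_)
      (Nat.cast_nonneg n)
    apply hBsmall
    have hq0 : (0 : ℝ) < q := by exact_mod_cast (Nat.prime_of_mem_primeFactors hq).pos
    have hqn : (q : ℝ) ≤ n := by exact_mod_cast Nat.le_of_mem_primeFactors hq
    calc Real.log q ≤ Real.log n := Real.log_le_log hq0 hqn
      _ ≤ Real.log x := Real.log_le_log (by exact_mod_cast (show 0 < n by omega)) hnx'.le
      _ ≤ 3 + ℓ ^ 2 := by linarith
  -- assemble
  have hsub : Finset.Ico 1 ⌈x⌉₊ ⊆ Finset.Icc 1 X := by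
    intro n hn
    obtain ⟨hn1, hnx⟩ := Finset.mem_Ico.mp hn
    exact Finset.mem_Icc.mpr ⟨hn1, by omega⟩
  have hmaj := sum_gMaj_div_le c' D hX2 hBp
  have hK0 : 0 ≤ 129 / 4 + 5 * M0 := by linarith [M0_nonneg]
  have hexp : Real.exp (4 * (3 : ℕ) + (129 / 4 + 5 * M0) * Bsum c' D * Real.log (4 * X) + M0 +
      C5 * LogEulerProduct.tailConst 4) ≤ C₀ := by
    rw [hC₀]
    apply Real.exp_le_exp.mpr
    have : (129 / 4 + 5 * M0) * Bsum c' D * Real.log (4 * X) ≤ (129 / 4 + 5 * M0) * (36 * π) := by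
      rw [mul_assoc]
      apply mul_le_mul_of_nonneg_left _ hK0
      calc Bsum c' D * Real.log (4 * X) ≤ Bsum c' D * (3 + ℓ ^ 2) :=
            mul_le_mul_of_nonneg_left hlog4X hB0
        _ ≤ 36 * π := hsmall36
    linarith
  have hC₀0 : 0 ≤ C₀ := (Real.exp_pos _).le
  have hpow : Real.log X ^ (3 : ℕ) ≤ (1 + Real.log x) ^ 3 := pow_le_pow_left₀ hlogX0 hlogX 3
  calc ∑ n ∈ Finset.Ico 1 ⌈x⌉₊, ‖Skeleton.xiZero c' D j n d r‖ / n
      ≤ ∑ n ∈ Finset.Ico 1 ⌈x⌉₊, gMaj c' D n / n := sum_le_sum hterm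
    _ ≤ ∑ n ∈ Finset.Icc 1 X, gMaj c' D n / n :=
        sum_le_sum_of_subset_of_nonneg hsub fun n _ _ =>
          div_nonneg (gMaj_nonneg c' D n) (Nat.cast_nonneg n)
    _ ≤ Real.exp (4 * (3 : ℕ) + (129 / 4 + 5 * M0) * Bsum c' D * Real.log (4 * X) + M0 +
          C5 * LogEulerProduct.tailConst 4) * Real.log X ^ (3 : ℕ) := hmaj
    _ ≤ C₀ * (1 + Real.log x) ^ 3 :=
        mul_le_mul hexp hpow (pow_nonneg hlogX0 3) hC₀0

end Literature.NumberTheory.LFunctions.Zhang2022.XiZeroMajorant
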